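/-
Copyright (c) 2026 the pub-hodgecm-mathlib formalisation cell (harness21).  Prover seat hodgecm-mathlib-K2E3-p11 (g5), Track B «K2-LIT» ∕ h413
(`stmt-HodgeConjecture-24833`), line `K2_E3_EllipticInputs`, unit U12 §L, Richardson road for (LBGL-ge3) at `N = 3` (road owner K2E3-p11), brick (F-E) =
(LBGL-3E) «THE (2,1)-PARABOLIC SLICE DENSITY OF 𝔤𝔩₃(F)», FILE E″2 «THE HAAR-EXACT DEPTH CHART AT A BLOCK-REGULAR LEVI POINT OF 𝔤𝔩₃(F)».  2026-09-04.
-/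
import Summits.HodgeConjecture.HodgeConjecture.Theorems.K2E3GL3ParabolicChartDeriv          -- ★ E″1 (this seat): `hasStrictFDerivAt_parabolicChart`, `det_rowAction`, `parabolicChart_zero`, §1 algebra
import Summits.HodgeConjecture.HodgeConjecture.Theorems.F0P3cStCharTSStrictDerivNewton     -- ★ p851993 (F0P2-p01): `exists_depth_chart` (Schikhof §27: Haar-exact Newton charts)
import Summits.HodgeConjecture.HodgeConjecture.Theorems.K2E3GLnMaximalParabolicDescent      -- ★ p857137 (K2E3-p11 g4): `map_continuousLinearEquiv_addHaar_matrix`, matrix LCS ∕ 2nd-countability ∕ regularity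
import Literature.NumberTheory.GaloisRepresentations.LocalFieldFiniteExtension              -- ★ R1 frame: `nontriviallyNormedField`, `norm_le_norm_iff_vle`, completeness, ultrametricity
import Literature.NumberTheory.Automorphic.LocalRingUnitModulusProduct                      -- ★ `UnitaryGroup.distribHaarChar_eq_normAbs`
import Literature.NumberTheory.Automorphic.LocalFieldHaarBalls                              -- ★ `primePowBall` kit, `exists_normAbs_eq_inv`
import Literature.MeasureTheory.Group.LocalFieldGLnVolume                                  -- ★ boxes `M₃(𝔭^k)`: `isOpen∕isCompact_setOf_forall_mem_primePowBall`
import HarnessLib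

/-!
# K2_E3 road (h413), §L ∕ Richardson road at `N = 3`, brick (F-E) FILE E″2: the Haar-exact depth chart `Φ_m` at a block-regular Levi point of `𝔤𝔩₃(F)`

Cell `pub/hodgecm-mathlib` (D-0151), Track B, seat K2E3-p11 (g5) (road owner of (F-E) = (LBGL-3E) `sig_K2E3GL3ParabolicSliceDensity`; ROAD v2 on `K2/STATUS.md`,
2026-09-04).  `--supports stmt-HodgeConjecture-24833 --as helper`; THEOREMS ONLY (no definition ∕ instance ∕ notation ∕ named fact ∕ `sorry`); never imports
`Cruxes/…/Lines`.  COUNT-NEUTRAL.  The (2,1)-parabolic twin of ★ E2 `K2E3GL3RegularDiagonalOrbitChart` (K2E3-p17 (g6)), over ★ E″1 `K2E3GL3ParabolicChartDeriv`.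

THE POINT.  `M(m) = [[m₀, m₁, 0], [m₂, m₃, 0], [0, 0, m₄]]` is a `(G, M)`-regular point of the `(2,1)`-Levi subalgebra `𝔪 ⊂ 𝔭 ⊂ 𝔤𝔩₃(F)`: `χ(m) = χ_A(m₄) ≠ 0`,
`A = [[m₀, m₁], [m₂, m₃]]`.  By ★ E″1 the parabolic chart `Φ_m(X) = (1 + L X)(M(m) + X_𝔭)(1 − L X)` (`L X` = the `𝔫⁻`-row of `X`, `X_𝔭 = X − L X`) has strict
derivative at `0` the row action `e_m` (`𝔭`-coordinates fixed, `𝔫⁻`-row `↦ (X₂₀, X₂₁)·(A − m₄·1)`), `det e_m = χ(m)`.  ★ `exists_depth_chart` (the ultrametric Newton chart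
of the road «HC-D», Schikhof §27) then makes `Φ_m` INJECTIVE on every deep box `Λ_k = M₃(𝔭^k)`, with image the compact open `V_k(m) = M(m) + e_m(Λ_k) ∋ M(m)`, and
HAAR-EXACT:
  `∫⁻_{Λ_k} h ∘ Φ_m dμ𝔤 = ‖χ(m)‖_F⁻¹ · ∫⁻_{V_k(m)} h dμ𝔤`,
the factor being the module of `e_m` (★ `map_continuousLinearEquiv_addHaar_matrix`, ★ `distribHaarChar_eq_normAbs`).  This is the Lie-side local input of ROAD v2 for
the (2,1)-parabolic slice density `∫_K ∫_𝔭 f(Ad(k)P) dP dk = ∫ f·W dμ𝔤` (`W(X) = c·Σ_{λ ∈ F, χ_X(λ)=0} ‖χ_X'(λ)‖_F⁻¹`): the fibre of `K × 𝔭 → 𝔤` over a regular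
semisimple `X` is the set of its `F`-rational eigenvalues, and the local pullback at the eigenvalue `m₄` is this chart (files G″∕H″).
* `continuous_parabolicChart`;  **`exists_depth_parabolicChart`** — injectivity ∕ image `= M(m) + e_m(Λ_k)` ∕ compact-open ∋ `M(m)` ∕ the `∫⁻` identity, boxes
  spelled `{X | ∀ i j, X i j ∈ primePowBall F k}` (norm-free statement; the valuation norm and the elementwise sup norm live inside the proof — R1 frame).
[HarishChandra1999AdmissibleDistributions, §7 Lemma 7.8] [HarishChandra1970, Part V §4 Lemma 22] [Schikhof1984, §27 Lemma 27.4–Thm. 27.5] [WeilBNT1967, Ch. I §2]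
HONEST LABEL: HC_CM is proved only modulo the 7 printed citations (2 remaining named inputs: hLiu418 = stmt-HodgeConjecture-24832, h413 = stmt-HodgeConjecture-24833)
until rung 0 closes; count-neutral helper ((LBGL-ge3)∕(LBGL-3E) NOT ★ here).

## References
* [HarishChandra1999AdmissibleDistributions] Harish-Chandra (DeBacker–Sally), *Admissible Invariant Distributions on Reductive p-adic Groups* (1999), §7, Lemma 7.8.
* [HarishChandra1970] Harish-Chandra (van Dijk), *Harmonic Analysis on Reductive p-adic Groups*, LNM 162 (1970), Part V §4 Lemma 22.
* [Schikhof1984] W. H. Schikhof, *Ultrametric Calculus* (1984), §27 Lemma 27.4–Thm. 27.5.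
* [WeilBNT1967] A. Weil, *Basic Number Theory* (1967), Ch. I §2.
-/

set_option autoImplicit false
set_option linter.dupNamespace false

noncomputable section

open MeasureTheory Measure Filter Topology Set Matrix
open scoped MatrixGroups NNReal ENNReal Pointwise
open Literature.NumberTheory.Automorphic Literature.NumberTheory.Automorphic.LocalFieldHaar
open Literature.NumberTheory.GaloisRepresentations Literature.NumberTheory.GaloisRepresentations.IsNonarchimedeanLocalField
open Summit.HodgeConjecture.HodgeConjecture.Cruxes.H413.F0P3cStCharTSStrictDerivNewton
open Summit.HodgeConjecture.HodgeConjecture.Cruxes.H413.K2E3GLnMaximalParabolicDescent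
open Summit.HodgeConjecture.HodgeConjecture.Cruxes.H413.K2E3GL3ParabolicChartDeriv

namespace Summit.HodgeConjecture.HodgeConjecture.Cruxes.H413.K2E3GL3ParabolicOrbitChart

/-! ## The local field: continuity of the chart and THE DEPTH CHART at a block-regular Levi point -/

section LocalField

variable {F : Type*} [Field F] [ValuativeRel F] [TopologicalSpace F] [IsNonarchimedeanLocalField F]
  [MeasurableSpace F] [BorelSpace F]
  [MeasurableSpace (Matrix (Fin 3) (Fin 3) F)] [BorelSpace (Matrix (Fin 3) (Fin 3) F)]

omit [MeasurableSpace F] [BorelSpace F] [MeasurableSpace (Matrix (Fin 3) (Fin 3) F)] [BorelSpace (Matrix (Fin 3) (Fin 3) F)] in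
/-- The chart `Φ_m` is continuous (a polynomial map of `M₃(F)`). [folklore] -/
theorem continuous_parabolicChart (m : Fin 5 → F) :
    Continuous (fun X : Matrix (Fin 3) (Fin 3) F =>
        (1 + (!![0, 0, 0; 0, 0, 0; X 2 0, X 2 1, 0] : Matrix (Fin 3) (Fin 3) F)) *
          (!![m 0, m 1, 0; m 2, m 3, 0; 0, 0, m 4] + !![X 0 0, X 0 1, X 0 2; X 1 0, X 1 1, X 1 2; 0, 0, X 2 2]) *
          (1 - !![0, 0, 0; 0, 0, 0; X 2 0, X 2 1, 0])) := by
  haveI : IsTopologicalRing F := inferInstance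
  have hL : Continuous fun X : Matrix (Fin 3) (Fin 3) F => (!![0, 0, 0; 0, 0, 0; X 2 0, X 2 1, 0] : Matrix (Fin 3) (Fin 3) F) := by
    refine continuous_matrix fun i j => ?_
    fin_cases i <;> fin_cases j <;> simp <;> first | exact continuous_const | exact continuous_id.matrix_elem _ _
  have hP : Continuous fun X : Matrix (Fin 3) (Fin 3) F => (!![X 0 0, X 0 1, X 0 2; X 1 0, X 1 1, X 1 2; 0, 0, X 2 2] : Matrix (Fin 3) (Fin 3) F) := by
    refine continuous_matrix fun i j => ?_
    fin_cases i <;> fin_cases j <;> simp <;> first | exact continuous_const | exact continuous_id.matrix_elem _ _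
  refine Continuous.fun_mul (Continuous.fun_mul ?_ ?_) ?_
  · exact continuous_const.fun_add hL
  · exact continuous_const.fun_add hP
  · exact continuous_const.fun_sub hL

/-- **THE DEPTH CHART AT A BLOCK-REGULAR LEVI POINT OF `𝔤𝔩₃(F)`.**  Let `M(m) = [[m₀,m₁,0],[m₂,m₃,0],[0,0,m₄]]` with `χ(m) = χ_A(m₄) ≠ 0` (`A = [[m₀,m₁],[m₂,m₃]]`), `μ𝔤` an
additive Haar measure on `𝔤𝔩₃(F)`, and `Φ = Φ_m` the parabolic chart (`hΦ`).  There is a depth `k₀` such that for every `k ≥ k₀`, on the box `Λ_k = M₃(𝔭^k)`: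
(a) `Φ` is injective on `Λ_k`; (b) `Φ(Λ_k) = M(m) + e_m(Λ_k)` with `e_m` the row action (`𝔭`-coordinates fixed, `𝔫⁻`-row `↦ (X₂₀, X₂₁)·(A − m₄·1)`); (c) `Φ(Λ_k)` is open and
compact and contains `M(m)`; (d) HAAR-EXACTNESS — for every measurable `h ≥ 0`, `∫⁻_{Λ_k} h (Φ X) dμ𝔤 = ‖χ(m)‖_F⁻¹ · ∫⁻_{Φ(Λ_k)} h dμ𝔤`.  Proof: ★ `exists_depth_chart` on ★ E″1
(strict derivative `e_m`) for the ball filtration `Λ_j = closedBall 0 ‖ϖ‖^j` of the valuation norm (= the boxes `M₃(𝔭^j)`); the module of `e_m` is `‖det e_m‖_F = ‖χ(m)‖_F`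
(★ E″1 `det_rowAction`, ★ `map_continuousLinearEquiv_addHaar_matrix`, ★ `distribHaarChar_eq_normAbs`); translation invariance.
[cite: Schikhof1984, §27 Lemma 27.4–Thm. 27.5] [cite: HarishChandra1970, Part V §4 Lemma 22] [cite: HarishChandra1999AdmissibleDistributions, Lemma 7.8] -/
theorem exists_depth_parabolicChart (m : Fin 5 → F) (hm : (!![m 0, m 1; m 2, m 3] : Matrix (Fin 2) (Fin 2) F).charpoly.eval (m 4) ≠ 0)
    (μ𝔤 : Measure (Matrix (Fin 3) (Fin 3) F)) [μ𝔤.IsAddHaarMeasure]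
    (Φ : Matrix (Fin 3) (Fin 3) F → Matrix (Fin 3) (Fin 3) F)
    (hΦ : Φ = fun X : Matrix (Fin 3) (Fin 3) F =>
        (1 + (!![0, 0, 0; 0, 0, 0; X 2 0, X 2 1, 0] : Matrix (Fin 3) (Fin 3) F)) *
          (!![m 0, m 1, 0; m 2, m 3, 0; 0, 0, m 4] + !![X 0 0, X 0 1, X 0 2; X 1 0, X 1 1, X 1 2; 0, 0, X 2 2]) *
          (1 - !![0, 0, 0; 0, 0, 0; X 2 0, X 2 1, 0])) :
    ∃ k₀ : ℕ, ∀ k : ℕ, k₀ ≤ k →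
      Set.InjOn Φ {X : Matrix (Fin 3) (Fin 3) F | ∀ i j, X i j ∈ primePowBall F k} ∧
      Φ '' {X : Matrix (Fin 3) (Fin 3) F | ∀ i j, X i j ∈ primePowBall F k} =
        (!![m 0, m 1, 0; m 2, m 3, 0; 0, 0, m 4] : Matrix (Fin 3) (Fin 3) F) +ᵥ
          ((fun X : Matrix (Fin 3) (Fin 3) F =>
              (!![X 0 0, X 0 1, X 0 2; X 1 0, X 1 1, X 1 2; X 2 0 * (m 0 - m 4) + X 2 1 * m 2, X 2 0 * m 1 + X 2 1 * (m 3 - m 4), X 2 2] :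
                Matrix (Fin 3) (Fin 3) F)) '' {X : Matrix (Fin 3) (Fin 3) F | ∀ i j, X i j ∈ primePowBall F k}) ∧
      IsOpen (Φ '' {X : Matrix (Fin 3) (Fin 3) F | ∀ i j, X i j ∈ primePowBall F k}) ∧
      IsCompact (Φ '' {X : Matrix (Fin 3) (Fin 3) F | ∀ i j, X i j ∈ primePowBall F k}) ∧
      (!![m 0, m 1, 0; m 2, m 3, 0; 0, 0, m 4] : Matrix (Fin 3) (Fin 3) F) ∈ Φ '' {X : Matrix (Fin 3) (Fin 3) F | ∀ i j, X i j ∈ primePowBall F k} ∧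
      (∀ h : Matrix (Fin 3) (Fin 3) F → ℝ≥0∞, Measurable h →
        ∫⁻ X in {X : Matrix (Fin 3) (Fin 3) F | ∀ i j, X i j ∈ primePowBall F k}, h (Φ X) ∂μ𝔤 =
          ((normAbs F ((!![m 0, m 1; m 2, m 3] : Matrix (Fin 2) (Fin 2) F).charpoly.eval (m 4)))⁻¹ : ℝ≥0) *
            ∫⁻ Y in Φ '' {X : Matrix (Fin 3) (Fin 3) F | ∀ i j, X i j ∈ primePowBall F k}, h Y ∂μ𝔤) := by
  classical
  -- ===== R1 frame, inside the proof only =====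
  letI : NontriviallyNormedField F := IsNonarchimedeanLocalField.nontriviallyNormedField F
  haveI : CompleteSpace F := IsNonarchimedeanLocalField.completeSpace_nontriviallyNormedField F
  haveI : IsUltrametricDist F := IsNonarchimedeanLocalField.isUltrametricDist_nontriviallyNormedField F
  haveI : ProperSpace F := ProperSpace.of_nontriviallyNormedField_of_weaklyLocallyCompactSpace F
  haveI : T2Space F := (isLocalField F).toT2Space
  haveI : SecondCountableTopology F := secondCountableTopology_localField F
  haveI : IsTopologicalRing F := inferInstance
  letI : NormedAddCommGroup (Matrix (Fin 3) (Fin 3) F) := Matrix.normedAddCommGroup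
  letI : NormedSpace F (Matrix (Fin 3) (Fin 3) F) := Matrix.normedSpace
  haveI : IsUltrametricDist (Matrix (Fin 3) (Fin 3) F) := inferInstanceAs (IsUltrametricDist (Fin 3 → Fin 3 → F))
  haveI : ProperSpace (Matrix (Fin 3) (Fin 3) F) := inferInstanceAs (ProperSpace (Fin 3 → Fin 3 → F))
  haveI : LocallyCompactSpace (Matrix (Fin 3) (Fin 3) F) := locallyCompactSpace_matrix (F := F) (m := Fin 3) (n := Fin 3)
  haveI : SecondCountableTopology (Matrix (Fin 3) (Fin 3) F) := secondCountableTopology_matrix (F := F) (m := Fin 3) (n := Fin 3)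
  haveI : μ𝔤.Regular := regular_of_isAddHaarMeasure (F := F) μ𝔤
  -- ===== the strict derivative and the row-action equivalence (★ E″1) =====
  have hm' : (m 4 - m 0) * (m 4 - m 3) - m 1 * m 2 ≠ 0 := by rwa [← K2E3GL3ParabolicNilTwist.eval_charpoly_fin_two]
  obtain ⟨e, he, hderiv⟩ := hasStrictFDerivAt_parabolicChart (K := F) m hm'
  rw [← hΦ] at hderiv
  -- the module of `e`: `det e = χ(m)`, `mod_F = ‖·‖_F`
  have hdet : LinearEquiv.det e.toLinearEquiv =
      Units.mk0 ((!![m 0, m 1; m 2, m 3] : Matrix (Fin 2) (Fin 2) F).charpoly.eval (m 4)) hm :=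
    Units.ext (by rw [Units.val_mk0]; exact det_rowAction m e.toLinearEquiv he)
  have hmapμ : μ𝔤.map (e : Matrix (Fin 3) (Fin 3) F → Matrix (Fin 3) (Fin 3) F) =
      ((normAbs F ((!![m 0, m 1; m 2, m 3] : Matrix (Fin 2) (Fin 2) F).charpoly.eval (m 4)))⁻¹ : ℝ≥0) • μ𝔤 := by
    rw [map_continuousLinearEquiv_addHaar_matrix μ𝔤 e, hdet, UnitaryGroup.distribHaarChar_eq_normAbs, Units.val_mk0]
  -- ===== the ball filtration `Λ_j = closedBall 0 ‖ϖ‖^j = M₃(𝔭^j)` =====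
  obtain ⟨ϖ, hϖ0, hϖ⟩ := exists_normAbs_eq_inv (F := F)
  have hγ0 : 0 < ‖ϖ‖ := norm_pos_iff.2 hϖ0
  have hγ1 : ‖ϖ‖ < 1 := by
    rw [IsNonarchimedeanLocalField.norm_lt_one_iff, ← normAbs_lt_one_iff, hϖ]
    exact inv_lt_one_of_one_lt₀ (by exact_mod_cast one_lt_residueFieldCard F)
  obtain ⟨Λ, hΛ⟩ := Literature.Analysis.Calculus.exists_addSubgroup_coe_eq_closedBall (V := Matrix (Fin 3) (Fin 3) F) one_pos hγ0
  have hbox : ∀ k : ℕ, (Λ k : Set (Matrix (Fin 3) (Fin 3) F)) = {X : Matrix (Fin 3) (Fin 3) F | ∀ i j, X i j ∈ primePowBall F k} := by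
    intro k
    rw [hΛ k, one_mul]
    ext X
    rw [mem_closedBall_zero_iff, Matrix.norm_le_iff (pow_nonneg hγ0.le k), Set.mem_setOf_eq]
    refine forall_congr' fun i => forall_congr' fun j => ?_
    rw [← norm_pow, IsNonarchimedeanLocalField.norm_le_norm_iff_vle, Valuation.Compatible.vle_iff_le (v := ValuativeRel.valuation F),
      ← normAbs_le_normAbs_iff, map_pow, hϖ, primePowBall, Set.mem_setOf_eq, zpow_natCast]
  -- ===== the depth chart (★ `exists_depth_chart`) =====
  -- Borel instances for the normed (defeq) topologies are passed explicitly (★ HC-D ∕ ★ E2 pattern)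
  obtain ⟨k₀, hk⟩ := @exists_depth_chart F _ (Matrix (Fin 3) (Fin 3) F) _ _ _ _ _ ‹BorelSpace (Matrix (Fin 3) (Fin 3) F)›
    (Matrix (Fin 3) (Fin 3) F) _ _ _ ‹BorelSpace (Matrix (Fin 3) (Fin 3) F)› μ𝔤 ‹μ𝔤.IsAddHaarMeasure›.toIsFiniteMeasureOnCompacts
    ‹μ𝔤.IsAddHaarMeasure›.toIsAddLeftInvariant Φ 0 e hderiv Λ 1 ‖ϖ‖ hΛ one_pos hγ0 hγ1
  refine ⟨k₀, fun k hkk => ?_⟩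
  obtain ⟨hinj, himg, -, hlin⟩ := hk k hkk
  have hΦ0 : Φ 0 = !![m 0, m 1, 0; m 2, m 3, 0; 0, 0, m 4] := by rw [hΦ]; exact parabolicChart_zero m
  have himg' : Φ '' {X : Matrix (Fin 3) (Fin 3) F | ∀ i j, X i j ∈ primePowBall F k} =
      (!![m 0, m 1, 0; m 2, m 3, 0; 0, 0, m 4] : Matrix (Fin 3) (Fin 3) F) +ᵥ
        ((e : Matrix (Fin 3) (Fin 3) F → Matrix (Fin 3) (Fin 3) F) '' {X : Matrix (Fin 3) (Fin 3) F | ∀ i j, X i j ∈ primePowBall F k}) := by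
    have h := himg k le_rfl 0 (Λ k).zero_mem
    rwa [add_zero, zero_vadd, hΦ0, hbox k] at h
  have hecoe : (e : Matrix (Fin 3) (Fin 3) F → Matrix (Fin 3) (Fin 3) F) = fun X : Matrix (Fin 3) (Fin 3) F =>
      (!![X 0 0, X 0 1, X 0 2; X 1 0, X 1 1, X 1 2; X 2 0 * (m 0 - m 4) + X 2 1 * m 2, X 2 0 * m 1 + X 2 1 * (m 3 - m 4), X 2 2] :
        Matrix (Fin 3) (Fin 3) F) := funext he
  have hboxopen : IsOpen {X : Matrix (Fin 3) (Fin 3) F | ∀ i j, X i j ∈ primePowBall F k} :=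
    Literature.MeasureTheory.Group.isOpen_setOf_forall_mem_primePowBall (F := F) (n := Fin 3) k
  have hboxcpt : IsCompact {X : Matrix (Fin 3) (Fin 3) F | ∀ i j, X i j ∈ primePowBall F k} :=
    Literature.MeasureTheory.Group.isCompact_setOf_forall_mem_primePowBall (F := F) (n := Fin 3) k
  have hboxm : MeasurableSet {X : Matrix (Fin 3) (Fin 3) F | ∀ i j, X i j ∈ primePowBall F k} := hboxopen.measurableSet
  have hΦc : Continuous Φ := by rw [hΦ]; exact continuous_parabolicChart m
  refine ⟨?_, ?_, ?_, hboxcpt.image hΦc, ⟨0, fun i j => zero_mem_primePowBall _, hΦ0⟩, fun h hmeas => ?_⟩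
  · -- (a) injectivity
    have h1 := hinj
    rwa [zero_vadd, hbox k] at h1
  · -- (b) the image
    rw [himg', hecoe]
  · -- (c) openness: `V_k = M(m) + e(Λ_k)`
    rw [himg', ← Set.image_vadd]
    exact (Homeomorph.addLeft (!![m 0, m 1, 0; m 2, m 3, 0; 0, 0, m 4] : Matrix (Fin 3) (Fin 3) F)).isOpenMap _ (e.toHomeomorph.isOpenMap _ hboxopen)
  · -- (d) Haar-exactness
    set S : Set (Matrix (Fin 3) (Fin 3) F) := {X : Matrix (Fin 3) (Fin 3) F | ∀ i j, X i j ∈ primePowBall F k} with hS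
    set M₀ : Matrix (Fin 3) (Fin 3) F := !![m 0, m 1, 0; m 2, m 3, 0; 0, 0, m 4] with hM₀
    -- ★'s identity, re-read in this context (definitional)
    have h1 : ∫⁻ v in S, h (Φ v) ∂μ𝔤 = ∫⁻ v in S, h (M₀ + e v) ∂μ𝔤 := by
      have h0 := hlin h hmeas
      simp only [zero_add, hΦ0, hbox k] at h0
      exact h0
    rw [h1]
    have heS : MeasurableSet ((e : Matrix (Fin 3) (Fin 3) F → Matrix (Fin 3) (Fin 3) F) '' S) :=
      (e.toHomeomorph.isOpenMap _ hboxopen).measurableSet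
    have hmeas_g : Measurable fun Y : Matrix (Fin 3) (Fin 3) F => h (M₀ + Y) := hmeas.comp (measurable_const_add _)
    -- `∫⁻_S h(M₀ + e v) = ∫⁻ (e S).indicator (h(M₀ + ·)) ∘ e`
    have hstep1 : ∫⁻ v in S, h (M₀ + e v) ∂μ𝔤 =
        ∫⁻ v, ((e : Matrix (Fin 3) (Fin 3) F → Matrix (Fin 3) (Fin 3) F) '' S).indicator (fun Y => h (M₀ + Y)) (e v) ∂μ𝔤 := by
      rw [← lintegral_indicator hboxm]
      refine lintegral_congr fun v => ?_
      by_cases hv : v ∈ S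
      · rw [Set.indicator_of_mem hv, Set.indicator_of_mem (e.injective.mem_set_image.2 hv)]
      · rw [Set.indicator_of_notMem hv, Set.indicator_of_notMem (fun h' => hv (e.injective.mem_set_image.1 h'))]
    -- the module of `e`
    have hstep2 : ∫⁻ v, ((e : Matrix (Fin 3) (Fin 3) F → Matrix (Fin 3) (Fin 3) F) '' S).indicator (fun Y => h (M₀ + Y)) (e v) ∂μ𝔤 =
        ((normAbs F ((!![m 0, m 1; m 2, m 3] : Matrix (Fin 2) (Fin 2) F).charpoly.eval (m 4)))⁻¹ : ℝ≥0) *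
          ∫⁻ Y, ((e : Matrix (Fin 3) (Fin 3) F → Matrix (Fin 3) (Fin 3) F) '' S).indicator (fun Y => h (M₀ + Y)) Y ∂μ𝔤 := by
      rw [← lintegral_map (hmeas_g.indicator heS) e.continuous.measurable, hmapμ, lintegral_smul_measure, ENNReal.smul_def, smul_eq_mul]
    -- translation by `M₀` and `V_k = M₀ + e S`
    have hVm : MeasurableSet (M₀ +ᵥ ((e : Matrix (Fin 3) (Fin 3) F → Matrix (Fin 3) (Fin 3) F) '' S)) := heS.const_vadd _
    have hstep3 : ∫⁻ Y, ((e : Matrix (Fin 3) (Fin 3) F → Matrix (Fin 3) (Fin 3) F) '' S).indicator (fun Y => h (M₀ + Y)) Y ∂μ𝔤 =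
        ∫⁻ Y in Φ '' S, h Y ∂μ𝔤 := by
      rw [himg', ← lintegral_indicator hVm,
        ← lintegral_add_left_eq_self (μ := μ𝔤) ((M₀ +ᵥ ((e : Matrix (Fin 3) (Fin 3) F → Matrix (Fin 3) (Fin 3) F) '' S)).indicator h) M₀]
      refine lintegral_congr fun Y => ?_
      by_cases hY : Y ∈ (e : Matrix (Fin 3) (Fin 3) F → Matrix (Fin 3) (Fin 3) F) '' S
      · rw [Set.indicator_of_mem hY, Set.indicator_of_mem]
        exact Set.vadd_mem_vadd_set_iff.2 hY
      · rw [Set.indicator_of_notMem hY, Set.indicator_of_notMem]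
        exact fun h' => hY (Set.vadd_mem_vadd_set_iff.1 h')
    rw [hstep1, hstep2, hstep3]

end LocalField

end Summit.HodgeConjecture.HodgeConjecture.Cruxes.H413.K2E3GL3ParabolicOrbitChart

end
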